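/-
Copyright (c) 2026. All rights reserved.
Released under Apache 2.0 license as described in the file LICENSE.
Authors: abc-iut cell, wave-4 seat abc-iut-w4-d059 (proof-only; row «T54·Rc-INVARIANCE»: the Thm 5.4 (i)/(ii)
predicates of the chart-produced decomposition data do not depend on the choice of §3 representatives).
-/
import Literature.AnabelianGeometry.SemiGraphs.ArithReferencePairCpt
import HarnessLib

/-!
# [SemiAnbd] §5 p. 65 / Thm 5.4 (i)(ii): the decomposition data PRODUCED from the tempered chart does not
# depend on the chosen representatives, up to conjugation (proof-only)

Mochizuki, *Semi-graphs of anabelioids*, Publ. RIMS **42** (2006), §5 p. 65: the decomposition groups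
`Π^temp_{𝔊,v} ⊆ Π^temp_𝔊` and `Π^temp_{𝔊,b} ⊆ Π^temp_{𝔊,v} ⊆ Π^temp_𝔊` are "well-defined up to conjugation in
`Π^temp_𝔊`"; Thm 5.4 (i)(ii) p. 66 are statements about their conjugacy classes (the verticial and the edge-like
subgroups of `Π^temp_𝔊`, Def 5.3 (iii)). [cite: MochizukiSemiAnbd2006, §5, p. 65]

PROOF-ONLY companion (abc-iut cell, layer L3, sub-DAG `plan/L3/SUBDAG-SemiAnbd-Thm54.md`, row
«T54·Rc-INVARIANCE», seat abc-iut-w4-d059 gen 4; named by the L3 lead's α101 as the brick that removes the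
binders `hRcV`/`hRcB` — "the chart representatives are the ones read off the presentation" — from the
integrated theorem of record).  No definition, no new named fact.  In the tree, abc-iut-w4-d053's producer
`decompositionDataOfChart R ι` (ArithDecompositionData.lean) builds the data of Def 5.3 / Thm 5.4 from ANY
compatible choice `R : ChartRepresentatives c` of §3 verticial / edge-like representatives; the VERTEX half of
its independence of `R` is already there (`isVerticial_decompositionDataOfChart_iff`: the verticial
representatives at `v` form one conjugacy class and commensurators are conjugation-equivariant).  This file
proves the EDGE half and concludes:

* `arithBrGp_eq_conjSubgroup_of_chartRepresentatives` — for two choices `R`, `R'` and a branch `b`,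
  `Π^temp_{𝔊,b}[R'] = ι(k) · Π^temp_{𝔊,b}[R] · ι(k)⁻¹` for some `k ∈ Π^temp_𝔾`.  For a branch abutting to a
  vertex this goes through this seat's dictionary `exists_pair_mem_arithBrGp_iff_cpt` (ArithReferencePairCpt.lean,
  valid for EVERY `R`): `Π^temp_{𝔊,b}[R]` is the full `Π^temp_𝔊`-stabiliser of the reference pro-branch
  `(x, y)` of `R.Hb b`; the edge-like representatives of one edge form one conjugacy class
  (`exists_conj_of_mem_edgeLikeSubgroups`, Thm 3.7 (iii)), so `R'.Hb b = k · R.Hb b · k⁻¹` is the stabiliser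
  of `(k·x, k·y)` AND of its own reference pair `(x', y')`, whence `{x', y'} = {k·x, k·y}`
  (`ends_eq_or_swap_of_stabilizer_iff_cpt`: a nontrivial compact stabiliser determines its end pair up to order) — and a
  PAIR-stabiliser does not see the order.  DESIGN POINT of record (this seat's gen-3 caveat): at a loop edge
  an unmatched `R'.Hb b` may be "the other branch's" edge-like subgroup; the argument above is insensitive to
  this precisely because both branch groups of one edge-lift are the pointwise stabiliser of that lift.
* `isEdgeLike_decompositionDataOfChart_iff_of_chartRepresentatives`,
  `isVerticial_decompositionDataOfChart_iff_of_chartRepresentatives` — the produced notions "edge-like" /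
  "verticial" (Def 5.3 (iii)) do not depend on `R`.
* `arithMaximalCompactStatementI_iff_of_chartRepresentatives`,
  `arithMaximalCompactStatementII_iff_of_chartRepresentatives` — the Thm 5.4 (i)/(ii) predicates of
  abc-iut-L3-t3's `ArithMaximalCompact.lean`, which see the data only through `IsVerticial`/`IsEdgeLike`,
  hold for `decompositionDataOfChart R ι` iff they hold for `decompositionDataOfChart R' ι`.

Binders (verbatim those of `exists_pair_mem_arithBrGp_iff_cpt`, the generic (AI3) currency): `ι` injective with
normal image, trees `T j` with equivariant functorial transitions, finite levels (`level`, `levelAct`, `quot`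
an immersion, `levelTrans`), the estrangement consequence `hnobpNCpt` at the finite levels (compact-`C` form of record, FINDING F-d029g3-1), and the two-sided
geometric dictionaries `hfixN`/`hstabN`/`hedgeN`/`hedgeFixN` for the restricted action — all DISCHARGED at
abc-iut-L3-d4's coset-graph tower by abc-iut-w4-d053's `hfixN/hstabN/hedgeN/hedgeFixN_of_cosetTower`
(ArithDictionariesOfCosetTower.lean), exactly as in `ArithLevelDataCpt.ofCosetTowerC`.  Nothing here takes a
side on [IUTchIII] Cor. 3.12; typed ≠ proved for anything not proved here.
-/

namespace Literature.AnabelianGeometry.SemiGraphs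

open CategoryTheory
open scoped Pointwise

universe v u u'

namespace ProfiniteSemiGraph

variable {𝒢 : ProfiniteSemiGraph.{u}} {c : TemperedPiChart 𝒢} {Gtp : Type u'} [Group Gtp]
  (ι : c.G →* Gtp) {J : Type v} [Preorder J] [IsDirectedOrder J]
  (T : J → SemiGraph.{u}) (ρ : ∀ j, Gtp →* Aut (T j)) (f : ∀ ⦃i j : J⦄, i ≤ j → (T j ⟶ T i))
  (level : J → SemiGraph.{u}) [∀ j, Finite (level j).Vertex] [∀ j, Finite (level j).Branch]
  (levelAct : ∀ j, Gtp →* Aut (level j)) (quot : ∀ j, T j ⟶ level j)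
  (levelTrans : ∀ ⦃i j : J⦄, i ≤ j → (level j ⟶ level i))

/-! ### Bookkeeping: conjugates -/

omit [Preorder J] [IsDirectedOrder J] in
/-- Fixing a vertex after conjugation: `g⁻¹ z g` fixes `y` iff `z` fixes `g · y`. [folklore] -/
private theorem act_conj_fix_iff (j : J) (g z : Gtp) (y : (T j).Vertex) :
    (ρ j (g⁻¹ * z * g)).hom.vertexMap y = y ↔
      (ρ j z).hom.vertexMap ((ρ j g).hom.vertexMap y) = (ρ j g).hom.vertexMap y := by
  rw [act_mul_vertexMap, act_mul_vertexMap]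
  constructor
  · intro h
    have := congrArg ((ρ j g).hom.vertexMap) h
    rwa [act_act_inv_vertexMap] at this
  · intro h
    rw [h, act_inv_act_vertexMap]

/-- Membership in a conjugate subgroup (abc-iut-L3-t3's `conjSubgroup g K = g K g⁻¹`). [folklore] -/
private theorem mem_conjSubgroup_iff_conj_mem {G : Type*} [Group G] {g y : G} {K : Subgroup G} :
    y ∈ conjSubgroup g K ↔ g⁻¹ * y * g ∈ K := by
  constructor
  · rintro ⟨z, hz, rfl⟩
    simpa [MulAut.conj_apply, mul_assoc] using hz
  · intro h
    exact ⟨g⁻¹ * y * g, h, by simp [MulAut.conj_apply, mul_assoc]⟩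

omit [Preorder J] [IsDirectedOrder J] in
/-- **The conjugate of a full PAIR-stabiliser is the full stabiliser of the translated pair**: if
`S = {z | z fixes x and y}` then `g S g⁻¹ = {z | z fixes g·x and g·y}`. [cite: MochizukiSemiAnbd2006, Thm 5.4 (i), p. 66] -/
private theorem mem_conjSubgroup_pairStabilizer_iff {S : Subgroup Gtp} {x y : ∀ j, (T j).Vertex}
    (hS : ∀ z : Gtp, z ∈ S ↔ (∀ j, (ρ j z).hom.vertexMap (x j) = x j) ∧
      ∀ j, (ρ j z).hom.vertexMap (y j) = y j) (g z : Gtp) :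
    z ∈ conjSubgroup g S ↔
      (∀ j, (ρ j z).hom.vertexMap ((ρ j g).hom.vertexMap (x j)) = (ρ j g).hom.vertexMap (x j)) ∧
        ∀ j, (ρ j z).hom.vertexMap ((ρ j g).hom.vertexMap (y j)) = (ρ j g).hom.vertexMap (y j) := by
  rw [mem_conjSubgroup_iff_conj_mem, hS]
  exact and_congr (forall_congr' fun j => act_conj_fix_iff T ρ j g z (x j))
    (forall_congr' fun j => act_conj_fix_iff T ρ j g z (y j))

/-- `ι` transports conjugation: `ι(k K k⁻¹) = ι(k) ι(K) ι(k)⁻¹`. [folklore] -/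
private theorem map_conj_map_eq (K : Subgroup c.G) (k : c.G) :
    (K.map (MulAut.conj k).toMonoidHom).map ι = conjSubgroup (ι k) (K.map ι) := by
  rw [conjSubgroup, Subgroup.map_map, Subgroup.map_map]
  congr 1
  ext x
  simp [MulAut.conj_apply]

/-- Iterated conjugation: `(a b) K (a b)⁻¹ = a (b K b⁻¹) a⁻¹`. [folklore] -/
private theorem conjSubgroup_mul_eq {G : Type*} [Group G] (a b : G) (K : Subgroup G) :
    conjSubgroup (a * b) K = conjSubgroup a (conjSubgroup b K) := by
  simp only [conjSubgroup, Subgroup.map_map]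
  congr 1
  ext x
  simp [MulAut.conj_apply, mul_assoc]

/-! ### The edge half: `Π^temp_{𝔊,b}` for two choices of representatives -/

/-- **`Π^temp_{𝔊,b}` is well-defined up to conjugation** ([SemiAnbd] §5 p. 65): for two compatible choices
`R`, `R'` of §3 representatives and any branch `b`, the produced branch groups are conjugate by an element of
`ι(Π^temp_𝔾)`: `arithBrGp R' ι b = ι(k) · arithBrGp R ι b · ι(k)⁻¹`.  For `b` abutting to a vertex: both
groups are full stabilisers of reference pro-branches (`exists_pair_mem_arithBrGp_iff_cpt`), `R'.Hb b = k R.Hb b k⁻¹`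
(`exists_conj_of_mem_edgeLikeSubgroups`) stabilises both the translate `(k·x, k·y)` of the reference pair of
`R.Hb b` and its own reference pair, so the two pairs agree up to order (`ends_eq_or_swap_of_stabilizer_iff_cpt`,
edge-like subgroups being compact);
for `b` abutting to no vertex the group is a bare commensurator (`commensurator_conjSubgroup`).
[cite: MochizukiSemiAnbd2006, §5, p. 65] -/
theorem arithBrGp_eq_conjSubgroup_of_chartRepresentatives (h𝒢 : 𝒢.Thm37Hypotheses)
    (hι : Function.Injective ι) (hnorm : (ι.range).Normal) (hT : ∀ j, (T j).IsTree)
    (f_id : ∀ j, f (le_refl j) = 𝟙 (T j))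
    (f_comp : ∀ ⦃i j k : J⦄ (hij : i ≤ j) (hjk : j ≤ k), f hjk ≫ f hij = f (hij.trans hjk))
    (trans_act : ∀ ⦃i j : J⦄ (h : i ≤ j) (g : Gtp), (ρ j g).hom ≫ f h = f h ≫ (ρ i g).hom)
    (quot_isImmersion : ∀ j, SemiGraph.IsImmersion (quot j))
    (act_quot : ∀ (j : J) (g : Gtp), (ρ j g).hom ≫ quot j = quot j ≫ (levelAct j g).hom)
    (levelTrans_id : ∀ j, levelTrans (le_refl j) = 𝟙 (level j))
    (levelTrans_comp : ∀ ⦃i j k : J⦄ (hij : i ≤ j) (hjk : j ≤ k),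
      levelTrans hjk ≫ levelTrans hij = levelTrans (hij.trans hjk))
    (levelTrans_act : ∀ ⦃i j : J⦄ (h : i ≤ j) (g : Gtp),
      (levelAct j g).hom ≫ levelTrans h = levelTrans h ≫ (levelAct i g).hom)
    (trans_quot : ∀ ⦃i j : J⦄ (h : i ≤ j), f h ≫ quot i = quot j ≫ levelTrans h)
    (hnobpNCpt : ∀ (C : Subgroup c.G), IsCompact (C : Set c.G) →
      ∀ (j₀ : J) (w : ∀ i : {i : J // j₀ ≤ i}, (level i.1).Vertex)
      (β β' : ∀ i : {i : J // j₀ ≤ i}, (level i.1).Branch),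
      (∀ i, β i ≠ β' i ∧ (level i.1).abuts (β i) = some (w i) ∧ (level i.1).abuts (β' i) = some (w i)) →
      (∀ ⦃i i' : {i : J // j₀ ≤ i}⦄ (h : i.1 ≤ i'.1), (levelTrans h).vertexMap (w i') = w i ∧
        (levelTrans h).branchMap (β i') = β i ∧ (levelTrans h).branchMap (β' i') = β' i) →
      (∀ (i : {i : J // j₀ ≤ i}) (γ : C), (levelAct i.1 (ι γ)).hom.vertexMap (w i) = w i ∧
        (levelAct i.1 (ι γ)).hom.branchMap (β i) = β i ∧
          (levelAct i.1 (ι γ)).hom.branchMap (β' i) = β' i) → C = ⊥)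
    (hfixN : ∀ (v : 𝒢.graph.Vertex) (H : Subgroup c.G), H ∈ verticialSubgroups c v →
      ∃ x : ∀ j, (T j).Vertex, (∀ ⦃i j : J⦄ (h : i ≤ j), (f h).vertexMap (x j) = x i) ∧
        ∀ n : c.G, n ∈ H ↔ ∀ j, (ρ j (ι n)).hom.vertexMap (x j) = x j)
    (hstabN : ∀ x : ∀ j, (T j).Vertex, (∀ ⦃i j : J⦄ (h : i ≤ j), (f h).vertexMap (x j) = x i) →
      ∃ (v : 𝒢.graph.Vertex) (H : Subgroup c.G), H ∈ verticialSubgroups c v ∧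
        ∀ n : c.G, n ∈ H ↔ ∀ j, (ρ j (ι n)).hom.vertexMap (x j) = x j)
    (hedgeN : ∀ (j₁ : J) (ε : ∀ j : {j : J // j₁ ≤ j}, (T j.1).Edge),
      (∀ ⦃i j : {j : J // j₁ ≤ j}⦄ (h : i.1 ≤ j.1), (f h).edgeMap (ε j) = ε i) →
      ∃ (e : 𝒢.graph.Edge) (L : Subgroup c.G), L ∈ edgeLikeSubgroups c e ∧
        ∀ n : c.G, n ∈ L ↔ ∀ j, (ρ j.1 (ι n)).hom.edgeMap (ε j) = ε j ∧
          ∀ b : (T j.1).Branch, (T j.1).edgeOf b = ε j → (ρ j.1 (ι n)).hom.branchMap b = b)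
    (hedgeFixN : ∀ (e : 𝒢.graph.Edge) (K : Subgroup c.G), K ∈ edgeLikeSubgroups c e →
      ∃ (j₁ : J) (ε : ∀ j : {j : J // j₁ ≤ j}, (T j.1).Edge) (c₁ c₂ : ∀ j : {j : J // j₁ ≤ j}, (T j.1).Branch)
        (x₁ x₂ : ∀ j, (T j).Vertex),
        (∀ ⦃i j : J⦄ (h : i ≤ j), (f h).vertexMap (x₁ j) = x₁ i) ∧
        (∀ ⦃i j : J⦄ (h : i ≤ j), (f h).vertexMap (x₂ j) = x₂ i) ∧
        (∀ j, x₁ j.1 ≠ x₂ j.1 ∧ (T j.1).edgeOf (c₁ j) = ε j ∧ (T j.1).edgeOf (c₂ j) = ε j ∧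
          (T j.1).abuts (c₁ j) = some (x₁ j.1) ∧ (T j.1).abuts (c₂ j) = some (x₂ j.1)) ∧
        ∀ n : c.G, n ∈ K ↔ ∀ j, (ρ j.1 (ι n)).hom.edgeMap (ε j) = ε j ∧
          ∀ b : (T j.1).Branch, (T j.1).edgeOf b = ε j → (ρ j.1 (ι n)).hom.branchMap b = b)
    (R R' : ChartRepresentatives c) (b : 𝒢.graph.Branch) :
    ∃ k : c.G, arithBrGp R' ι b = conjSubgroup (ι k) (arithBrGp R ι b) := by
  classical
  -- the edge-like representatives of one edge form one conjugacy class (Thm 3.7 (iii))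
  obtain ⟨k, hk⟩ := exists_conj_of_mem_edgeLikeSubgroups c (R.Hb_mem b) (R'.Hb_mem b)
  refine ⟨k, ?_⟩
  rcases hb : 𝒢.graph.abuts b with _ | v
  · -- `b` abuts to no vertex: both groups are bare commensurators
    have h1 : arithBrGp R ι b = Subgroup.Commensurable.commensurator ((R.Hb b).map ι) := by
      rw [arithBrGp, hb]; simp
    have h2 : arithBrGp R' ι b = Subgroup.Commensurable.commensurator ((R'.Hb b).map ι) := by
      rw [arithBrGp, hb]; simp
    rw [h1, h2, hk, map_conj_map_eq ι, commensurator_conjSubgroup]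
  · -- `b` abuts to `v`: reference pairs for `R` and `R'`
    obtain ⟨x, y, hx, hy, ⟨j₁, ε, c₁, c₂, hends⟩, hbxy, harith⟩ :=
      exists_pair_mem_arithBrGp_iff_cpt ι T ρ f level levelAct quot levelTrans h𝒢 R hι hnorm hT f_id f_comp
        trans_act quot_isImmersion act_quot levelTrans_id levelTrans_comp levelTrans_act trans_quot hnobpNCpt
        hfixN hstabN hedgeN hedgeFixN hb
    obtain ⟨x', y', hx', hy', ⟨j₁', ε', c₁', c₂', hends'⟩, hbxy', harith'⟩ :=
      exists_pair_mem_arithBrGp_iff_cpt ι T ρ f level levelAct quot levelTrans h𝒢 R' hι hnorm hT f_id f_comp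
        trans_act quot_isImmersion act_quot levelTrans_id levelTrans_comp levelTrans_act trans_quot hnobpNCpt
        hfixN hstabN hedgeN hedgeFixN hb
    -- the translate `(k·x, k·y)` is compatible
    have hequiv := trans_act_vertexMap' T ρ f trans_act
    have hkx : ∀ ⦃i j : J⦄ (h : i ≤ j),
        (f h).vertexMap ((ρ j (ι k)).hom.vertexMap (x j)) = (ρ i (ι k)).hom.vertexMap (x i) :=
      compatible_translate T ρ f hequiv hx (ι k)
    have hky : ∀ ⦃i j : J⦄ (h : i ≤ j),
        (f h).vertexMap ((ρ j (ι k)).hom.vertexMap (y j)) = (ρ i (ι k)).hom.vertexMap (y i) :=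
      compatible_translate T ρ f hequiv hy (ι k)
    -- `R'.Hb b = k R.Hb b k⁻¹` is the `Π^temp_𝔾`-stabiliser of `(k·x, k·y)`
    have hbk : ∀ n : c.G, n ∈ R'.Hb b ↔
        (∀ j, (ρ j (ι n)).hom.vertexMap ((ρ j (ι k)).hom.vertexMap (x j)) =
          (ρ j (ι k)).hom.vertexMap (x j)) ∧
        ∀ j, (ρ j (ι n)).hom.vertexMap ((ρ j (ι k)).hom.vertexMap (y j)) =
          (ρ j (ι k)).hom.vertexMap (y j) := by
      intro n
      rw [hk]
      change n ∈ conjSubgroup k (R.Hb b) ↔ _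
      rw [mem_conjSubgroup_iff_conj_mem, hbxy, map_mul, map_mul, map_inv]
      exact and_congr (forall_congr' fun j => act_conj_fix_iff T ρ j (ι k) (ι n) (x j))
        (forall_congr' fun j => act_conj_fix_iff T ρ j (ι k) (ι n) (y j))
    -- `R'.Hb b ≠ 1` determines its end pair up to order
    have hKbot : R'.Hb b ≠ ⊥ :=
      ne_bot_of_mem_edgeLikeSubgroups verticialInjective_holds h𝒢 c (R'.Hb_mem b)
    have hkxy : (ρ j₁ (ι k)).hom.vertexMap (x j₁) ≠ (ρ j₁ (ι k)).hom.vertexMap (y j₁) := by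
      intro h
      apply (hends ⟨j₁, le_rfl⟩).1
      have := congrArg ((ρ j₁ (ι k)⁻¹).hom.vertexMap) h
      rwa [act_inv_act_vertexMap, act_inv_act_vertexMap] at this
    have hx'y' : x' j₁' ≠ y' j₁' := (hends' ⟨j₁', le_rfl⟩).1
    have hKc : IsCompact (R'.Hb b : Set c.G) := isCompact_of_mem_edgeLikeSubgroups c (R'.Hb_mem b)
    rcases ends_eq_or_swap_of_stabilizer_iff_cpt ι T ρ f level levelAct quot levelTrans hT quot_isImmersion
        act_quot levelTrans_id levelTrans_comp levelTrans_act trans_quot hnobpNCpt hKbot hKc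
        (x := fun j => (ρ j (ι k)).hom.vertexMap (x j)) (y := fun j => (ρ j (ι k)).hom.vertexMap (y j))
        hkx hky hx' hy' hbk hbxy' hkxy hx'y' with ⟨h1, h2⟩ | ⟨h1, h2⟩
    · ext g
      rw [harith' g, mem_conjSubgroup_pairStabilizer_iff T ρ harith (ι k) g, h1, h2]
    · ext g
      rw [harith' g, mem_conjSubgroup_pairStabilizer_iff T ρ harith (ι k) g, h1, h2, and_comm]

/-- **The produced notion "edge-like" (Def 5.3 (iii)) does not depend on the chosen representatives**:
`IsEdgeLike (decompositionDataOfChart R ι) S ↔ IsEdgeLike (decompositionDataOfChart R' ι) S` — both are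
"`S` is a conjugate of some `Π^temp_{𝔊,b}`", and the `Π^temp_{𝔊,b}` of the two choices are conjugate
(`arithBrGp_eq_conjSubgroup_of_chartRepresentatives`). [cite: MochizukiSemiAnbd2006, Def 5.3 (iii), p. 65] -/
theorem isEdgeLike_decompositionDataOfChart_iff_of_chartRepresentatives (h𝒢 : 𝒢.Thm37Hypotheses)
    (hι : Function.Injective ι) (hnorm : (ι.range).Normal) (hT : ∀ j, (T j).IsTree)
    (f_id : ∀ j, f (le_refl j) = 𝟙 (T j))
    (f_comp : ∀ ⦃i j k : J⦄ (hij : i ≤ j) (hjk : j ≤ k), f hjk ≫ f hij = f (hij.trans hjk))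
    (trans_act : ∀ ⦃i j : J⦄ (h : i ≤ j) (g : Gtp), (ρ j g).hom ≫ f h = f h ≫ (ρ i g).hom)
    (quot_isImmersion : ∀ j, SemiGraph.IsImmersion (quot j))
    (act_quot : ∀ (j : J) (g : Gtp), (ρ j g).hom ≫ quot j = quot j ≫ (levelAct j g).hom)
    (levelTrans_id : ∀ j, levelTrans (le_refl j) = 𝟙 (level j))
    (levelTrans_comp : ∀ ⦃i j k : J⦄ (hij : i ≤ j) (hjk : j ≤ k),
      levelTrans hjk ≫ levelTrans hij = levelTrans (hij.trans hjk))
    (levelTrans_act : ∀ ⦃i j : J⦄ (h : i ≤ j) (g : Gtp),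
      (levelAct j g).hom ≫ levelTrans h = levelTrans h ≫ (levelAct i g).hom)
    (trans_quot : ∀ ⦃i j : J⦄ (h : i ≤ j), f h ≫ quot i = quot j ≫ levelTrans h)
    (hnobpNCpt : ∀ (C : Subgroup c.G), IsCompact (C : Set c.G) →
      ∀ (j₀ : J) (w : ∀ i : {i : J // j₀ ≤ i}, (level i.1).Vertex)
      (β β' : ∀ i : {i : J // j₀ ≤ i}, (level i.1).Branch),
      (∀ i, β i ≠ β' i ∧ (level i.1).abuts (β i) = some (w i) ∧ (level i.1).abuts (β' i) = some (w i)) →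
      (∀ ⦃i i' : {i : J // j₀ ≤ i}⦄ (h : i.1 ≤ i'.1), (levelTrans h).vertexMap (w i') = w i ∧
        (levelTrans h).branchMap (β i') = β i ∧ (levelTrans h).branchMap (β' i') = β' i) →
      (∀ (i : {i : J // j₀ ≤ i}) (γ : C), (levelAct i.1 (ι γ)).hom.vertexMap (w i) = w i ∧
        (levelAct i.1 (ι γ)).hom.branchMap (β i) = β i ∧
          (levelAct i.1 (ι γ)).hom.branchMap (β' i) = β' i) → C = ⊥)
    (hfixN : ∀ (v : 𝒢.graph.Vertex) (H : Subgroup c.G), H ∈ verticialSubgroups c v →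
      ∃ x : ∀ j, (T j).Vertex, (∀ ⦃i j : J⦄ (h : i ≤ j), (f h).vertexMap (x j) = x i) ∧
        ∀ n : c.G, n ∈ H ↔ ∀ j, (ρ j (ι n)).hom.vertexMap (x j) = x j)
    (hstabN : ∀ x : ∀ j, (T j).Vertex, (∀ ⦃i j : J⦄ (h : i ≤ j), (f h).vertexMap (x j) = x i) →
      ∃ (v : 𝒢.graph.Vertex) (H : Subgroup c.G), H ∈ verticialSubgroups c v ∧
        ∀ n : c.G, n ∈ H ↔ ∀ j, (ρ j (ι n)).hom.vertexMap (x j) = x j)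
    (hedgeN : ∀ (j₁ : J) (ε : ∀ j : {j : J // j₁ ≤ j}, (T j.1).Edge),
      (∀ ⦃i j : {j : J // j₁ ≤ j}⦄ (h : i.1 ≤ j.1), (f h).edgeMap (ε j) = ε i) →
      ∃ (e : 𝒢.graph.Edge) (L : Subgroup c.G), L ∈ edgeLikeSubgroups c e ∧
        ∀ n : c.G, n ∈ L ↔ ∀ j, (ρ j.1 (ι n)).hom.edgeMap (ε j) = ε j ∧
          ∀ b : (T j.1).Branch, (T j.1).edgeOf b = ε j → (ρ j.1 (ι n)).hom.branchMap b = b)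
    (hedgeFixN : ∀ (e : 𝒢.graph.Edge) (K : Subgroup c.G), K ∈ edgeLikeSubgroups c e →
      ∃ (j₁ : J) (ε : ∀ j : {j : J // j₁ ≤ j}, (T j.1).Edge) (c₁ c₂ : ∀ j : {j : J // j₁ ≤ j}, (T j.1).Branch)
        (x₁ x₂ : ∀ j, (T j).Vertex),
        (∀ ⦃i j : J⦄ (h : i ≤ j), (f h).vertexMap (x₁ j) = x₁ i) ∧
        (∀ ⦃i j : J⦄ (h : i ≤ j), (f h).vertexMap (x₂ j) = x₂ i) ∧
        (∀ j, x₁ j.1 ≠ x₂ j.1 ∧ (T j.1).edgeOf (c₁ j) = ε j ∧ (T j.1).edgeOf (c₂ j) = ε j ∧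
          (T j.1).abuts (c₁ j) = some (x₁ j.1) ∧ (T j.1).abuts (c₂ j) = some (x₂ j.1)) ∧
        ∀ n : c.G, n ∈ K ↔ ∀ j, (ρ j.1 (ι n)).hom.edgeMap (ε j) = ε j ∧
          ∀ b : (T j.1).Branch, (T j.1).edgeOf b = ε j → (ρ j.1 (ι n)).hom.branchMap b = b)
    (R R' : ChartRepresentatives c) (S : Subgroup Gtp) :
    IsEdgeLike (decompositionDataOfChart R ι) S ↔ IsEdgeLike (decompositionDataOfChart R' ι) S := by
  have key : ∀ R₁ R₂ : ChartRepresentatives c,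
      IsEdgeLike (decompositionDataOfChart R₁ ι) S → IsEdgeLike (decompositionDataOfChart R₂ ι) S := by
    rintro R₁ R₂ ⟨b, g, hS⟩
    obtain ⟨k, hk⟩ := arithBrGp_eq_conjSubgroup_of_chartRepresentatives ι T ρ f level levelAct quot
      levelTrans h𝒢 hι hnorm hT f_id f_comp trans_act quot_isImmersion act_quot levelTrans_id levelTrans_comp
      levelTrans_act trans_quot hnobpNCpt hfixN hstabN hedgeN hedgeFixN R₂ R₁ b
    refine ⟨b, g * ι k, ?_⟩
    rw [hS, decompositionDataOfChart_brGp, decompositionDataOfChart_brGp, hk, conjSubgroup_mul_eq]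
  exact ⟨key R R', key R' R⟩

/-! ### The vertex half (abc-iut-w4-d053's `isVerticial_decompositionDataOfChart_iff`, restated as invariance) -/

/-- **The produced notion "verticial" (Def 5.3 (iii)) does not depend on the chosen representatives** —
unconditionally: abc-iut-w4-d053's `isVerticial_decompositionDataOfChart_iff` describes it by an `R`-free
formula (the verticial representatives at `v` form one conjugacy class).
[cite: MochizukiSemiAnbd2006, Def 5.3 (iii), p. 65] -/
theorem isVerticial_decompositionDataOfChart_iff_of_chartRepresentatives (R R' : ChartRepresentatives c)
    (S : Subgroup Gtp) :
    IsVerticial (decompositionDataOfChart R ι) S ↔ IsVerticial (decompositionDataOfChart R' ι) S :=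
  (isVerticial_decompositionDataOfChart_iff R ι S).trans (isVerticial_decompositionDataOfChart_iff R' ι S).symm

end ProfiniteSemiGraph

/-! ### Thm 5.4 (i)/(ii) see the data only through its verticial and edge-like subgroups -/

section Statements

variable {Gtp : Type u'} [Group Gtp] [TopologicalSpace Gtp] {PA : Type*} [Group PA] [TopologicalSpace PA]
  {V B V' B' : Type*} {D : DecompositionData Gtp V B} {D' : DecompositionData Gtp V' B'}

/-- **Thm 5.4 (i) is a statement about the verticial and the edge-like subgroups only** ([SemiAnbd] p. 66:
"every arithmetically ample compact subgroup … is contained in at least one verticial subgroup …, whose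
intersection forms an edge-like subgroup"): two decomposition data over the same `Π^temp_𝔊 ↠ Π_A` with the
same verticial and the same edge-like subgroups satisfy `ArithMaximalCompactStatementI` simultaneously.
With `isVerticial/isEdgeLike_decompositionDataOfChart_iff_of_chartRepresentatives`: the predicate for
`decompositionDataOfChart R ι` does not depend on `R`. [cite: MochizukiSemiAnbd2006, Thm 5.4 (i), p. 66] -/
theorem arithMaximalCompactStatementI_iff_of_isVerticial_iff_of_isEdgeLike_iff (aug : Gtp →* PA)
    (hV : ∀ S : Subgroup Gtp, IsVerticial D S ↔ IsVerticial D' S)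
    (hE : ∀ S : Subgroup Gtp, IsEdgeLike D S ↔ IsEdgeLike D' S) :
    ArithMaximalCompactStatementI D aug ↔ ArithMaximalCompactStatementI D' aug := by
  simp only [ArithMaximalCompactStatementI, hV, hE]

/-- **Thm 5.4 (ii) is a statement about the verticial and the edge-like subgroups only** ([SemiAnbd] p. 66:
"the arithmetically maximal compact subgroups … are precisely the verticial subgroups; the arithmetically
ample intersections of two distinct [such] are precisely the edge-like subgroups"): as for (i).
[cite: MochizukiSemiAnbd2006, Thm 5.4 (ii), p. 66] -/
theorem arithMaximalCompactStatementII_iff_of_isVerticial_iff_of_isEdgeLike_iff (aug : Gtp →* PA)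
    (hV : ∀ S : Subgroup Gtp, IsVerticial D S ↔ IsVerticial D' S)
    (hE : ∀ S : Subgroup Gtp, IsEdgeLike D S ↔ IsEdgeLike D' S) :
    ArithMaximalCompactStatementII D aug ↔ ArithMaximalCompactStatementII D' aug := by
  simp only [ArithMaximalCompactStatementII, hV, hE]

end Statements

end Literature.AnabelianGeometry.SemiGraphs
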